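import Literature.AlgebraicGeometry.HodgeTheory.AbelianVarietyCyclotomicAutomorphismMultiplicities
import Literature.AlgebraicGeometry.HodgeTheory.AbelianVarietyAnalyticTypeProductsPowers
import Literature.AlgebraicGeometry.HodgeTheory.WeilClassesFieldAllOrNothing
import HarnessLib

/-!
# The Weil classes `W_{ℚ(δ)} ⊂ H^{2g/φ(m)}(A, ℚ)` of a cyclotomic automorphism `Φ_m(δ) = 0`:
# Moonen–Zarhin's criterion read on Zarhin's multiplicity function — `W_{ℚ(ζ_m)}` consists of Hodge
# classes iff `n_ζ(δ) = n_{ζ⁻¹}(δ)` for every primitive `ζ` (prime `p`: iff `𝐚(h) = 𝐚(−h)` for all `h`),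
# and `0` is its only Hodge class otherwise (always so when `2g/φ(m)` is odd)

Family `hodge`, lane `lit-hodgefound` (seat p03, GEN 36 «Hodge classes from the analytic type of a cyclotomic
automorphism»), topic `Literature/AlgebraicGeometry/HodgeTheory`.  Theorems only: no definition, no instance, no named
fact (net Literature debt 0).  Junction BY NAME of two stories of the tree:

* GEN 35's ANALYTIC TYPE of an endomorphism `δ` of a complex abelian variety `A` (dimension `g`) satisfying the `m`-th
  cyclotomic equation `Φ_m(δ) = 0` in `End A` (`AbelianVarietyCyclotomicAutomorphismMultiplicities`): the
  multiplicities `n_ζ(δ) = eigenMultiplicity A δ ζ` of the primitive `m`-th roots of unity `ζ` on `T₀A` (equivalently on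
  `H^{1,0}`), Zarhin's function `𝐚(h) = n_{ζ^h}(δ)` on `G = (ℤ/p)^*` for a prime `m = p`, with
  `(n_ζ + n_{ζ⁻¹}) · φ(m) = 2g` («admissibility»);
* the tree's WEIL CLASSES OF A FIELD `F = ℚ(φ) ≅ ℚ[T]/(P) ⊂ End⁰(A)` (`weilClassesField A φ P r = W_F ⊗ ℂ =
  ⊕_{P(ρ)=0} ⋀ʳ V_{ℂ,ρ} ⊂ Hʳ(A(ℂ); ℂ)`, `WeilClassesMoonenZarhinCriterion`), Moonen–Zarhin's CRITERION — PROVED in the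
  tree (`MoonenZarhin1998_weilClasses_hodgeCriterion_holds`, `forall_isOfHodgeType_weilClassesField_iff_balanced`) — and
  its «all or nothing» companions (`WeilClassesFieldAllOrNothing`, `Deligne1982.finrank_weilClassesField_eq_natDegree`).

Here `F = ℚ(δ) ≅ ℚ(ζ_m)` is the CYCLOTOMIC FIELD generated by `δ` (`P = Φ_m`, irreducible over `ℚ` of degree `φ(m)`;
Zarhin: «This gives rise to the embeddings `ℤ[ζ_p] ↪ End(X)`, `ℚ(ζ_p) ↪ End⁰(X)`»), its complex embeddings are
`δ ↦ ζ` for the primitive `m`-th roots `ζ`, complex conjugation is `ζ ↦ ζ⁻¹`, `r = 2g/φ(m)`, and Moonen–Zarhin's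
multiplicity `n_σ` IS Zarhin's `n_ζ(δ)`.  So the criterion reads on the analytic type of `δ` alone.

## Sources, verbatim (held texts)

B. Moonen, Yu. Zarhin, *Weil classes on abelian varieties*, J. reine angew. Math. 496 (1998) = alg-geom/9612017, held
`paper:arxiv-alg-geom_9612017`, chunk p0001: L32–L41 «suppose `F` is a subfield of `End⁰(X)`, with `1 ∈ F` acting as the
identity on `X`. Write `V_X = H¹(X,ℚ)` and let `r = 2g/[F:ℚ]`. The 1-dimensional `F`-vector space `W_F = W_F(X) := ⋀^r_F V_X`
can be identified in a natural manner with a subspace of `H^r(X,ℚ)` […] We call `W_F` the space of Weil classes with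
respect to `F`»; L57–L63 «Since `dim_F(W_F) = 1`, it readily follows that either all elements of `W_F` are Hodge classes,
or `0 ∈ W_F` is the only Hodge class»; L78–L81 «The dimension `n_σ` of `V^{1,0}_{ℂ,σ}` is called the multiplicity of `σ`
on the tangent space of `X`; we have `n_σ + n_{σ′} = 2g/[F:ℚ]` for all `σ ∈ Σ_F`»; L93–L97 «**Criterion.** If
`n_σ = n_{σ′}` for all `σ ∈ Σ_F` then `W_F` consists entirely of Hodge classes; if `n_σ ≠ n_{σ′}` for some `σ ∈ Σ_F`
then the zero class is the only Hodge class in `W_F`»; chunk p0002 L1–L8 «Example. Let `X = Y_1 × Y_2` where the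
ratios `2dim(Y_1)/[F:ℚ]` and `2dim(Y_2)/[F:ℚ]` are odd. Then non-zero elements of `W_F(Y_1)` and `W_F(Y_2)` are not
Hodge classes».

Yu. G. Zarhin, *Jacobians with automorphisms of prime order*, Math. Research Reports (2021) = arXiv:2109.06794, held
`paper:arxiv-2109.06794`, §1 chunk p0003: L16–L24 «`δ` an automorphism of `(X, λ)` that satisfies the cyclotomic
equation `Σ_{j=0}^{p-1} δ^j = 0` in `End(X)`. […] This gives rise to the embeddings `ℤ[ζ_p] ↪ End(X)`,
`ℚ(ζ_p) ↪ End⁰(X)`»; L38–L42 «the `j`th summands corresponds to the field embedding `ℚ(ζ_p) ↪ ℂ` that sends `ζ_p` to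
`ζ_p^j`. So, `ℚ(ζ_p)` acts on `Ω¹(X)` with multiplicities `a_j` (`j = 1, …, p−1`)»; L54–L57 «`a_j + a_{p−j} = 2g/(p−1)`
[…] this is a special case of a general well known result about endomorphism fields of complex abelian varieties: see,
e.g., [MoonenZarhin]»; L88–L104 (Example 1.3) «`Y_1 = E^{f(1)}`, `Y_2 = E^{f(2)}`, `Y = Y_1 × Y_2` […] the automorphism
`δ_3` of `Y` that acts (diagonally) as `δ_E` on `Y_1` and as `δ_E^{-1}` on `Y_2` […] `𝐚_Y(1) = f(1)`, `𝐚_Y(2) = f(2)`».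

P. Deligne (J. Milne), *Hodge cycles on abelian varieties*, LNM 900 (1982), §4 p. 30 / (4.4): `d · [E:ℚ] = 2 dim A`,
`dim_E ⋀^d_E H¹ = 1`, «`a_σ = b_σ = d/2`» (the tree's `Deligne1982.finrank_weilClassesField_eq_natDegree`,
`IsWeilTypeCM`).

## What is proved (namespace `Literature.AlgebraicGeometry.HodgeTheory.AbelianVariety`)

Throughout `hm : 0 < m`, `hδ : Φ_m(δ) = 0` (`(cyclotomic m ℤ).eval₂ (Int.castRingHom (End A)) (End.of δ) = 0`) and the
degree `r` with `hr : φ(m) · r = 2 dim A` (it exists: `totient_dvd_two_mul_dim`); `W := weilClassesField A δ (cyclotomic m ℤ) r`.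

* §0 `eval₂_cyclotomic_int_eq_zero_iff` — the complex roots of `Φ_m ∈ ℤ[X]` are the primitive `m`-th roots (the
  embeddings `Σ_F` of `F = ℚ(ζ_m)`); `forall_root_eigenMultiplicity_eq_conj_iff`, `exists_root_eigenMultiplicity_ne_conj_iff`
  — Moonen–Zarhin's balance `n_ρ = n_ρ̄` over the roots IS the symmetry `n_ζ = n_{ζ⁻¹}` of Zarhin's function.
* §1 THE SPACE `W_{ℚ(ζ_m)}`: `weilClassesField_cyclotomic_eq_iSup_primitiveRoots` (`W = ⊕_{ζ ∈ μ_m^×} ⋀ʳ V_ζ`),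
  `finrank_weilClassesField_cyclotomic_eq_totient` (`dim_ℂ W = φ(m) = [ℚ(ζ_m):ℚ]`, «`dim_F W_F = 1`»),
  `finrank_eigenspace_complexBetti_eq_of_isPrimitiveRoot` (`dim V_ζ = r`), `add_eigenMultiplicity_inv_eq_of_isPrimitiveRoot`
  (`n_ζ + n_{ζ⁻¹} = r`), `exists_isRationalClass_ne_zero_mem_weilClassesField_cyclotomic` (`W` has non-zero RATIONAL classes).
* §2 THE CRITERION ON THE ANALYTIC TYPE: **`isOfHodgeType_of_mem_weilClassesField_cyclotomic`** (symmetric type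
  `∀ ζ, n_ζ = n_{ζ⁻¹}` ⟹ every class of `W` is of type `(r/2, r/2)`), **`eq_zero_of_mem_weilClassesField_cyclotomic`** (some
  `n_ζ ≠ n_{ζ⁻¹}` ⟹ every rational `(r/2, r/2)`-class of `W` is `0`), the iff
  **`forall_isOfHodgeType_weilClassesField_cyclotomic_iff`**, and the tangible form
  **`exists_isRationalClass_isOfHodgeType_ne_zero_cyclotomic_iff`** (`A` carries a NON-ZERO RATIONAL HODGE CLASS in
  `W ⊂ Hʳ` iff the type is symmetric); the arithmetic of symmetry `forall_eigenMultiplicity_eq_inv_iff_two_mul_eq`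
  (`⟺ 2 n_ζ = r` for all `ζ`), `…_iff_mul_totient_eq_dim` (`⟺ n_ζ · φ(m) = g` for all `ζ`), `totient_dvd_dim_of_symmetric`
  (symmetric ⟹ `φ(m) ∣ g`), `exists_eigenMultiplicity_ne_inv_of_odd` (Moonen–Zarhin's Example: `r` odd ⟹ asymmetric),
  `eq_zero_of_mem_weilClassesField_cyclotomic_of_odd`, `…_of_not_totient_dvd_dim`; in even degree `r = 2k` (`φ(m) · k = g`):
  `eq_zero_of_mem_weilClassesField_cyclotomic_two_mul`, `forall_not_mem_divisorClassesSpan_of_exists_eigenMultiplicity_ne_inv`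
  (asymmetric ⟹ no non-zero rational Weil class is decomposable) and `weilClassesField_cyclotomic_trichotomy` (the printed
  trichotomy for `F = ℚ(ζ_m)`).
* §3 PRIME ORDER `p`, Zarhin's `𝐚(h) = n_{ζ^h}`: `forall_eigenMultiplicity_eq_inv_iff_of_prime` (symmetric ⟺
  `𝐚(j) = 𝐚(p−j)` for `1 ≤ j < p`), `…_iff_mul_sub_one_eq_dim_of_prime` (⟺ `𝐚(j)(p−1) = g` for all `j`: the CONSTANT
  function), `isOfHodgeType_of_mem_weilClassesField_cyclotomic_of_prime`, `eq_zero_of_mem_weilClassesField_cyclotomic_of_prime`,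
  `eq_zero_of_mem_weilClassesField_cyclotomic_of_not_sub_one_dvd_dim` (`(p−1) ∤ g` ⟹ `0` is the only rational Hodge
  class in `W_{ℚ(ζ_p)} ⊂ H^{2g/(p−1)}`).
* §4 ZARHIN'S EXAMPLE 1.3, `Y = E^{f(1)} × E^{f(2)}` with `δ_3 = (δ_E, …, δ_E⁻¹, …)` (`E` a `ℤ[ζ_3]`-curve:
  `dim E = 1`, `Φ_3(δ_E) = 0`, `n_ω(δ_E) = 1`), `W_{ℚ(ζ_3)}(Y) ⊂ H^{f(1)+f(2)}(Y)`:
  **`forall_isOfHodgeType_weilClassesField_zarhinExample_iff`** (all of `W` is Hodge ⟺ `f(1) = f(2)`),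
  `exists_isRationalClass_isOfHodgeType_ne_zero_zarhinExample` (`f(1) = f(2)`, `Y ≠ 0` ⟹ a non-zero rational Hodge class
  in `W ⊂ H^{2f(1)}`), `eq_zero_of_mem_weilClassesField_zarhinExample` (`f(1) ≠ f(2)` ⟹ `0` only).

Honesty clause.  Everything here is the tree's proved criterion specialised to `P = Φ_m`; no Weil class is shown
algebraic or decomposable; the polarization plays no role and is not assumed.

## References

* [MoonenZarhin1998WeilClasses] B. J. J. Moonen, Yu. G. Zarhin, *Weil classes on abelian varieties*, J. reine angew.
  Math. 496 (1998) 83–92 = arXiv:alg-geom/9612017, §1: definition of `W_F`, «all or nothing», the multiplicities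
  `n_σ`, Criterion, Example (chunks p0001 L32–L97, p0002 L1–L8).
* [Zarhin2021PrimeOrderJacobians] Yu. G. Zarhin, *Jacobians with automorphisms of prime order*, Math. Research Reports
  (2021), arXiv:2109.06794, §1 (1.1)–(1.3), Def. 1.1, Example 1.3 (chunk p0003).
* [Deligne1982HodgeCycles] P. Deligne (notes by J. S. Milne), *Hodge cycles on abelian varieties*, LNM 900 (1982), §4
  p. 30, (4.4), Prop. 4.4.
* [vanGeemen1994HodgeAV] B. van Geemen, *An introduction to the Hodge conjecture for abelian varieties*, LNM 1594
  (1994), 4.9–4.11, Thm. 6.12 (the quadratic case).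
-/

noncomputable section

open CategoryTheory CategoryTheory.Limits Module Polynomial

namespace Literature.AlgebraicGeometry.HodgeTheory

namespace AbelianVariety

open Literature.AlgebraicTopology.SingularHomology
open Literature.AlgebraicGeometry.Motives (IsSmoothProjective)
open Literature.AlgebraicGeometry.Deligne1982 (finrank_weilClassesField_eq_natDegree)
open Literature.Barriers.HodgeConjecture (divisorClassesSpan)

/-! ## §0 The embeddings of `ℚ(ζ_m)`: roots of `Φ_m` = primitive roots, conjugation = inversion -/

section Cyclotomic

variable {m : ℕ}

/-- **The complex roots of `Φ_m ∈ ℤ[X]` are exactly the primitive `m`-th roots of unity** — the set `Σ_F` of complex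
embeddings of `F = ℚ(ζ_m)` («the field embedding `ℚ(ζ_p) ↪ ℂ` that sends `ζ_p` to `ζ_p^j`», `j = 1, …, p−1`).
[cite: Zarhin2021PrimeOrderJacobians, §1 (chunk p0003 L38–L42)] [cite: MoonenZarhin1998WeilClasses, §1 (chunk p0001 L74–L81)] -/
theorem eval₂_cyclotomic_int_eq_zero_iff (hm : 0 < m) {ζ : ℂ} :
    (cyclotomic m ℤ).eval₂ (Int.castRingHom ℂ) ζ = 0 ↔ IsPrimitiveRoot ζ m := by
  haveI : NeZero (m : ℂ) := ⟨Nat.cast_ne_zero.2 hm.ne'⟩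
  rw [← Polynomial.eval_map, map_cyclotomic]
  exact ⟨fun h ↦ isRoot_cyclotomic_iff.1 (IsRoot.def.2 h), fun h ↦ IsRoot.def.1 (h.isRoot_cyclotomic hm)⟩

/-- `Φ_m ∈ ℤ[X]` is irreducible over `ℚ` (`[ℚ(ζ_m):ℚ] = φ(m)`). [cite: MoonenZarhin1998WeilClasses, §1 (chunk p0001 L32–L41)] -/
private theorem irreducible_cyclotomic_int_map_rat (hm : 0 < m) :
    Irreducible ((cyclotomic m ℤ).map (Int.castRingHom ℚ)) := by
  rw [map_cyclotomic]
  exact cyclotomic.irreducible_rat hm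

/-- Complex conjugation on the roots of unity is inversion: `ζ̄ = ζ⁻¹` (the conjugate embedding `σ′` of `σ : ζ_m ↦ ζ` is
`ζ_m ↦ ζ⁻¹`). [cite: MoonenZarhin1998WeilClasses, §1 (chunk p0001 L74–L81)] -/
private theorem starRingEnd_eq_inv_of_isPrimitiveRoot (hm : 0 < m) {ζ : ℂ} (hζ : IsPrimitiveRoot ζ m) :
    starRingEnd ℂ ζ = ζ⁻¹ :=
  (Complex.inv_eq_conj (Complex.norm_eq_one_of_pow_eq_one hζ.pow_eq_one hm.ne')).symm

variable {A : Motives.AbelianVariety ℂ} {δ : A ⟶ A}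

/-- **Moonen–Zarhin's balance IS the symmetry of Zarhin's function**: `n_ρ(δ) = n_ρ̄(δ)` for every complex root `ρ` of
`Φ_m` iff `n_ζ(δ) = n_{ζ⁻¹}(δ)` for every primitive `m`-th root `ζ` («`n_σ = n_{σ′}` for all `σ ∈ Σ_F`» ⟷
«`𝐚(h) = 𝐚(−h)`»). [cite: MoonenZarhin1998WeilClasses, §1 Criterion (chunk p0001 L93–L97)]
[cite: Zarhin2021PrimeOrderJacobians, §1 (1.3), Def. 1.1 (chunk p0003 L54–L88)] -/
theorem forall_root_eigenMultiplicity_eq_conj_iff (hm : 0 < m) :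
    (∀ ρ : ℂ, (cyclotomic m ℤ).eval₂ (Int.castRingHom ℂ) ρ = 0 →
        eigenMultiplicity A δ ρ = eigenMultiplicity A δ (starRingEnd ℂ ρ)) ↔
      ∀ ζ : ℂ, IsPrimitiveRoot ζ m → eigenMultiplicity A δ ζ = eigenMultiplicity A δ ζ⁻¹ := by
  constructor
  · intro h ζ hζ
    rw [← starRingEnd_eq_inv_of_isPrimitiveRoot hm hζ]
    exact h ζ ((eval₂_cyclotomic_int_eq_zero_iff hm).2 hζ)
  · intro h ρ hρ
    have hζ : IsPrimitiveRoot ρ m := (eval₂_cyclotomic_int_eq_zero_iff hm).1 hρ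
    rw [starRingEnd_eq_inv_of_isPrimitiveRoot hm hζ]
    exact h ρ hζ

/-- The negation: SOME root is unbalanced iff Zarhin's function is asymmetric somewhere, `n_ζ ≠ n_{ζ⁻¹}`.
[cite: MoonenZarhin1998WeilClasses, §1 Criterion (chunk p0001 L93–L97)] [cite: Zarhin2021PrimeOrderJacobians, §1 Def. 1.1 (chunk p0003 L77–L88)] -/
theorem exists_root_eigenMultiplicity_ne_conj_iff (hm : 0 < m) :
    (∃ ρ : ℂ, (cyclotomic m ℤ).eval₂ (Int.castRingHom ℂ) ρ = 0 ∧
        eigenMultiplicity A δ ρ ≠ eigenMultiplicity A δ (starRingEnd ℂ ρ)) ↔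
      ∃ ζ : ℂ, IsPrimitiveRoot ζ m ∧ eigenMultiplicity A δ ζ ≠ eigenMultiplicity A δ ζ⁻¹ := by
  constructor
  · rintro ⟨ρ, hρ, hne⟩
    have hζ : IsPrimitiveRoot ρ m := (eval₂_cyclotomic_int_eq_zero_iff hm).1 hρ
    rw [starRingEnd_eq_inv_of_isPrimitiveRoot hm hζ] at hne
    exact ⟨ρ, hζ, hne⟩
  · rintro ⟨ζ, hζ, hne⟩
    rw [← starRingEnd_eq_inv_of_isPrimitiveRoot hm hζ] at hne
    exact ⟨ζ, (eval₂_cyclotomic_int_eq_zero_iff hm).2 hζ, hne⟩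

end Cyclotomic

/-! ## §1 The space `W_{ℚ(ζ_m)} ⊗ ℂ = ⊕_{ζ ∈ μ_m^×} ⋀ʳ V_ζ ⊂ Hʳ(A(ℂ); ℂ)`, `r · φ(m) = 2g` -/

section WeilSpace

variable {A : Motives.AbelianVariety ℂ} {δ : A ⟶ A} {m r : ℕ}

/-- **`W_{ℚ(ζ_m)} ⊗ ℂ = ⊕_{ζ primitive} ⋀ʳ V_{ℂ,ζ}`**: for `F = ℚ(δ) ≅ ℚ(ζ_m)` the summands of
«`W_F ⊗ ℂ = ⊕_{σ ∈ Σ_F} ⋀^r_ℂ V_{ℂ,σ}`» are indexed by the primitive `m`-th roots of unity (`σ : δ ↦ ζ`).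
[cite: MoonenZarhin1998WeilClasses, §1 (chunk p0001 L82–L88)] [cite: Zarhin2021PrimeOrderJacobians, §1 (chunk p0003 L38–L42)] -/
theorem weilClassesField_cyclotomic_eq_iSup_primitiveRoots (hm : 0 < m) (δ : A ⟶ A) (r : ℕ) :
    weilClassesField A δ (cyclotomic m ℤ) r =
      ⨆ ζ ∈ primitiveRoots m ℂ, pullbackEigenclasses A δ r (fun x y ↦ ((x : ℂ) + (y : ℂ) * ζ) ^ r) := by
  apply le_antisymm
  · unfold weilClassesField
    refine iSup₂_le fun ρ hρ ↦ ?_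
    have hρ' : ρ ∈ primitiveRoots m ℂ :=
      (mem_primitiveRoots hm).2 ((eval₂_cyclotomic_int_eq_zero_iff hm).1 hρ)
    exact le_iSup₂_of_le (f := fun ζ (_ : ζ ∈ primitiveRoots m ℂ) ↦
      pullbackEigenclasses A δ r (fun x y ↦ ((x : ℂ) + (y : ℂ) * ζ) ^ r)) ρ hρ' le_rfl
  · refine iSup₂_le fun ζ hζ ↦ ?_
    exact pullbackEigenclasses_le_weilClassesField
      ((eval₂_cyclotomic_int_eq_zero_iff hm).2 ((mem_primitiveRoots hm).1 hζ))

/-- **`dim_ℂ (W_{ℚ(ζ_m)} ⊗ ℂ) = φ(m) = [ℚ(ζ_m):ℚ]`** («The 1-dimensional `F`-vector space `W_F`»; `r ≠ 0`).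
[cite: MoonenZarhin1998WeilClasses, §1 (chunk p0001 L32–L41, L57–L63)] [cite: Deligne1982HodgeCycles, §4 p. 30] -/
theorem finrank_weilClassesField_cyclotomic_eq_totient (hm : 0 < m)
    (hδ : (cyclotomic m ℤ).eval₂ (Int.castRingHom (End A)) (End.of δ) = 0) (hr : Nat.totient m * r = 2 * A.dim)
    (hr0 : r ≠ 0) : finrank ℂ ↥(weilClassesField A δ (cyclotomic m ℤ) r) = Nat.totient m :=
  finrank_weilClassesField_eq_natDegree (Motives.AbelianVariety.isSmoothProjective_holds (A := A)) δ
    (natDegree_cyclotomic m ℤ) (irreducible_cyclotomic_int_map_rat hm) hδ hr hr0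

/-- **`dim_ℂ V_{ℂ,ζ} = r`** for every primitive `m`-th root `ζ`: `H¹(A, ℚ)` is free of rank `r = 2g/φ(m)` over
`ℚ(ζ_m)` (`V_ℂ = ⊕_σ V_{ℂ,σ}`; Zarhin: the rational representation is `2g/(p−1)` copies of the regular one of
`ℚ(ζ_p)`). [cite: MoonenZarhin1998WeilClasses, §1 (chunk p0001 L74–L81)] [cite: Deligne1982HodgeCycles, §4 (4.4)] -/
theorem finrank_eigenspace_complexBetti_eq_of_isPrimitiveRoot (hm : 0 < m)
    (hδ : (cyclotomic m ℤ).eval₂ (Int.castRingHom (End A)) (End.of δ) = 0) (hr : Nat.totient m * r = 2 * A.dim)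
    {ζ : ℂ} (hζ : IsPrimitiveRoot ζ m) :
    finrank ℂ ↥(Module.End.eigenspace (complexBetti.map δ.hom.hom.hom 1).hom ζ) = r :=
  finrank_eigenspace_eq_of_root (cyclotomic.monic m ℤ) (natDegree_cyclotomic m ℤ)
    (irreducible_cyclotomic_int_map_rat hm) hδ hr ((eval₂_cyclotomic_int_eq_zero_iff hm).2 hζ)

/-- **Admissibility in degree form: `n_ζ(δ) + n_{ζ⁻¹}(δ) = r`** for every primitive `m`-th root `ζ` («we have
`n_σ + n_{σ′} = 2g/[F:ℚ]` for all `σ ∈ Σ_F`»; «`a_j + a_{p−j} = 2g/(p−1)`»).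
[cite: MoonenZarhin1998WeilClasses, §1 (chunk p0001 L78–L81)] [cite: Zarhin2021PrimeOrderJacobians, §1 (1.3) (chunk p0003 L54–L57)] -/
theorem add_eigenMultiplicity_inv_eq_of_isPrimitiveRoot (hm : 0 < m)
    (hδ : (cyclotomic m ℤ).eval₂ (Int.castRingHom (End A)) (End.of δ) = 0) (hr : Nat.totient m * r = 2 * A.dim)
    {ζ : ℂ} (hζ : IsPrimitiveRoot ζ m) :
    eigenMultiplicity A δ ζ + eigenMultiplicity A δ ζ⁻¹ = r := by
  rw [← starRingEnd_eq_inv_of_isPrimitiveRoot hm hζ]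
  exact eigenMultiplicity_add_eigenMultiplicity_conj_eq (cyclotomic.monic m ℤ) (natDegree_cyclotomic m ℤ)
    (irreducible_cyclotomic_int_map_rat hm) hδ hr ((eval₂_cyclotomic_int_eq_zero_iff hm).2 hζ)

/-- **`W_{ℚ(ζ_m)}` has non-zero elements**: `W ⊗ ℂ` contains a non-zero RATIONAL class (it is spanned by its rational
points and contains the line `⋀ʳ V_ζ ≠ 0`). [cite: MoonenZarhin1998WeilClasses, §1 (chunk p0001 L32–L41)]
[cite: Deligne1982HodgeCycles, §4 (4.4)] -/
theorem exists_isRationalClass_ne_zero_mem_weilClassesField_cyclotomic (hm : 0 < m)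
    (hδ : (cyclotomic m ℤ).eval₂ (Int.castRingHom (End A)) (End.of δ) = 0) (hr : Nat.totient m * r = 2 * A.dim) :
    ∃ γ ∈ weilClassesField A δ (cyclotomic m ℤ) r, IsRationalClass γ ∧ γ ≠ 0 :=
  exists_isRationalClass_ne_zero_mem_weilClassesField (cyclotomic.monic m ℤ) (natDegree_cyclotomic m ℤ)
    (irreducible_cyclotomic_int_map_rat hm) hδ hr

end WeilSpace

/-! ## §2 The criterion on the analytic type: `W_{ℚ(ζ_m)}` is Hodge ⟺ `n_ζ = n_{ζ⁻¹}` for all primitive `ζ` -/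

section Criterion

variable {A : Motives.AbelianVariety ℂ} {δ : A ⟶ A} {m r : ℕ}

/-- **Criterion (i) for `F = ℚ(ζ_m)`: a SYMMETRIC analytic type makes every Weil class Hodge.**  If
`n_ζ(δ) = n_{ζ⁻¹}(δ)` for every primitive `m`-th root `ζ`, every class of `W_{ℚ(ζ_m)} ⊗ ℂ ⊂ Hʳ(A(ℂ); ℂ)`,
`r · φ(m) = 2g`, is of Hodge type `(r/2, r/2)` («If `n_σ = n_{σ′}` for all `σ ∈ Σ_F` then `W_F` consists entirely
of Hodge classes»). [cite: MoonenZarhin1998WeilClasses, §1 Criterion (chunk p0001 L93–L97)]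
[cite: Zarhin2021PrimeOrderJacobians, §1 Def. 1.1 (chunk p0003 L77–L88)] -/
theorem isOfHodgeType_of_mem_weilClassesField_cyclotomic (hm : 0 < m)
    (hδ : (cyclotomic m ℤ).eval₂ (Int.castRingHom (End A)) (End.of δ) = 0) (hr : Nat.totient m * r = 2 * A.dim)
    (hsym : ∀ ζ : ℂ, IsPrimitiveRoot ζ m → eigenMultiplicity A δ ζ = eigenMultiplicity A δ ζ⁻¹)
    {c : complexBetti A.X r} (hc : c ∈ weilClassesField A δ (cyclotomic m ℤ) r) :
    IsOfHodgeType A.dim A.X r (r / 2) (r / 2) c :=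
  isOfHodgeType_of_mem_weilClassesField_of_balanced (cyclotomic.monic m ℤ) (natDegree_cyclotomic m ℤ)
    (irreducible_cyclotomic_int_map_rat hm) hδ hr ((forall_root_eigenMultiplicity_eq_conj_iff hm).2 hsym) hc

/-- **Criterion (ii) for `F = ℚ(ζ_m)`: an ASYMMETRIC analytic type kills every rational Hodge class of `W`.**  If
`n_ζ(δ) ≠ n_{ζ⁻¹}(δ)` for some primitive `m`-th root `ζ`, every RATIONAL class of `W_{ℚ(ζ_m)} ⊗ ℂ` of Hodge type
`(r/2, r/2)` is `0` («if `n_σ ≠ n_{σ′}` for some `σ ∈ Σ_F` then the zero class is the only Hodge class in `W_F`»).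
[cite: MoonenZarhin1998WeilClasses, §1 Criterion (chunk p0001 L93–L97)] -/
theorem eq_zero_of_mem_weilClassesField_cyclotomic (hm : 0 < m)
    (hδ : (cyclotomic m ℤ).eval₂ (Int.castRingHom (End A)) (End.of δ) = 0) (hr : Nat.totient m * r = 2 * A.dim)
    (hasym : ∃ ζ : ℂ, IsPrimitiveRoot ζ m ∧ eigenMultiplicity A δ ζ ≠ eigenMultiplicity A δ ζ⁻¹)
    {c : complexBetti A.X r} (hc : c ∈ weilClassesField A δ (cyclotomic m ℤ) r) (hcQ : IsRationalClass c)
    (hcH : IsOfHodgeType A.dim A.X r (r / 2) (r / 2) c) : c = 0 :=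
  eq_zero_of_mem_weilClassesField_of_unbalanced (cyclotomic.monic m ℤ) (natDegree_cyclotomic m ℤ)
    (irreducible_cyclotomic_int_map_rat hm) hδ hr ((exists_root_eigenMultiplicity_ne_conj_iff hm).2 hasym) hc hcQ hcH

/-- **The criterion as an equivalence**: ALL of `W_{ℚ(ζ_m)} ⊗ ℂ` is of type `(r/2, r/2)` iff Zarhin's function is
symmetric, `n_ζ(δ) = n_{ζ⁻¹}(δ)` for every primitive `ζ`. [cite: MoonenZarhin1998WeilClasses, §1 Criterion and «all or
nothing» (chunk p0001 L57–L63, L93–L97)] -/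
theorem forall_isOfHodgeType_weilClassesField_cyclotomic_iff (hm : 0 < m)
    (hδ : (cyclotomic m ℤ).eval₂ (Int.castRingHom (End A)) (End.of δ) = 0) (hr : Nat.totient m * r = 2 * A.dim) :
    (∀ c ∈ weilClassesField A δ (cyclotomic m ℤ) r, IsOfHodgeType A.dim A.X r (r / 2) (r / 2) c) ↔
      ∀ ζ : ℂ, IsPrimitiveRoot ζ m → eigenMultiplicity A δ ζ = eigenMultiplicity A δ ζ⁻¹ := by
  rw [forall_isOfHodgeType_weilClassesField_iff_balanced (cyclotomic.monic m ℤ) (natDegree_cyclotomic m ℤ)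
    (irreducible_cyclotomic_int_map_rat hm) hδ hr, forall_root_eigenMultiplicity_eq_conj_iff hm]

/-- **Hodge classes from the analytic type, tangibly**: `A` carries a NON-ZERO RATIONAL class of Hodge type
`(r/2, r/2)` inside `W_{ℚ(ζ_m)} ⊗ ℂ ⊂ Hʳ(A(ℂ); ℂ)` (`r ≠ 0`) iff `n_ζ(δ) = n_{ζ⁻¹}(δ)` for every primitive `ζ` — the
Weil–Hodge classes of the cyclotomic automorphism. [cite: MoonenZarhin1998WeilClasses, §1 Criterion and «all or nothing»
(chunk p0001 L57–L63, L93–L97)] [cite: Zarhin2021PrimeOrderJacobians, §1 Def. 1.1 (chunk p0003 L77–L88)] -/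
theorem exists_isRationalClass_isOfHodgeType_ne_zero_cyclotomic_iff (hm : 0 < m)
    (hδ : (cyclotomic m ℤ).eval₂ (Int.castRingHom (End A)) (End.of δ) = 0) (hr : Nat.totient m * r = 2 * A.dim)
    (hr0 : r ≠ 0) :
    (∃ γ ∈ weilClassesField A δ (cyclotomic m ℤ) r,
        IsRationalClass γ ∧ IsOfHodgeType A.dim A.X r (r / 2) (r / 2) γ ∧ γ ≠ 0) ↔
      ∀ ζ : ℂ, IsPrimitiveRoot ζ m → eigenMultiplicity A δ ζ = eigenMultiplicity A δ ζ⁻¹ := by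
  rw [exists_isRationalClass_isOfHodgeType_ne_zero_iff_balanced (cyclotomic.monic m ℤ) (natDegree_cyclotomic m ℤ)
    (irreducible_cyclotomic_int_map_rat hm) hδ hr hr0, forall_root_eigenMultiplicity_eq_conj_iff hm]

/-- Symmetric type ⟹ a non-zero rational Hodge class of type `(r/2, r/2)` in `W_{ℚ(ζ_m)} ⊗ ℂ` (`r ≠ 0`).
[cite: MoonenZarhin1998WeilClasses, §1 Criterion (chunk p0001 L93–L97)] -/
theorem exists_isRationalClass_isOfHodgeType_ne_zero_of_symmetric (hm : 0 < m)
    (hδ : (cyclotomic m ℤ).eval₂ (Int.castRingHom (End A)) (End.of δ) = 0) (hr : Nat.totient m * r = 2 * A.dim)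
    (hr0 : r ≠ 0) (hsym : ∀ ζ : ℂ, IsPrimitiveRoot ζ m → eigenMultiplicity A δ ζ = eigenMultiplicity A δ ζ⁻¹) :
    ∃ γ ∈ weilClassesField A δ (cyclotomic m ℤ) r,
      IsRationalClass γ ∧ IsOfHodgeType A.dim A.X r (r / 2) (r / 2) γ ∧ γ ≠ 0 :=
  (exists_isRationalClass_isOfHodgeType_ne_zero_cyclotomic_iff hm hδ hr hr0).2 hsym

/-- **Symmetry ⟺ `2 n_ζ = r` for every primitive `ζ`** (with `n_ζ + n_{ζ⁻¹} = r`): the symmetric types are the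
constant ones, `n_ζ = r/2 = g/φ(m)`. [cite: Zarhin2021PrimeOrderJacobians, §1 (1.3), Def. 1.1 (chunk p0003 L54–L88)]
[cite: MoonenZarhin1998WeilClasses, §1 (chunk p0001 L78–L81)] -/
theorem forall_eigenMultiplicity_eq_inv_iff_two_mul_eq (hm : 0 < m)
    (hδ : (cyclotomic m ℤ).eval₂ (Int.castRingHom (End A)) (End.of δ) = 0) (hr : Nat.totient m * r = 2 * A.dim) :
    (∀ ζ : ℂ, IsPrimitiveRoot ζ m → eigenMultiplicity A δ ζ = eigenMultiplicity A δ ζ⁻¹) ↔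
      ∀ ζ : ℂ, IsPrimitiveRoot ζ m → 2 * eigenMultiplicity A δ ζ = r := by
  refine forall₂_congr fun ζ hζ ↦ ?_
  have h := add_eigenMultiplicity_inv_eq_of_isPrimitiveRoot hm hδ hr hζ
  omega

/-- **Symmetry ⟺ `n_ζ · φ(m) = g` for every primitive `ζ`** (no reference to `r`; `(n_ζ + n_{ζ⁻¹}) · φ(m) = 2g`).
[cite: Zarhin2021PrimeOrderJacobians, §1 (1.3), Def. 1.1 (chunk p0003 L54–L88)] [cite: MoonenZarhin1998WeilClasses, §1 (chunk p0001 L78–L81)] -/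
theorem forall_eigenMultiplicity_eq_inv_iff_mul_totient_eq_dim (hm : 0 < m)
    (hδ : (cyclotomic m ℤ).eval₂ (Int.castRingHom (End A)) (End.of δ) = 0) :
    (∀ ζ : ℂ, IsPrimitiveRoot ζ m → eigenMultiplicity A δ ζ = eigenMultiplicity A δ ζ⁻¹) ↔
      ∀ ζ : ℂ, IsPrimitiveRoot ζ m → eigenMultiplicity A δ ζ * Nat.totient m = A.dim := by
  refine forall₂_congr fun ζ hζ ↦ ?_
  have h := add_eigenMultiplicity_inv_mul_totient_eq hm hδ hζ
  have hφ : 0 < Nat.totient m := Nat.totient_pos.2 hm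
  rw [add_mul] at h
  constructor
  · intro heq
    rw [← heq] at h
    omega
  · intro heq
    have h' : eigenMultiplicity A δ ζ⁻¹ * Nat.totient m = eigenMultiplicity A δ ζ * Nat.totient m := by omega
    exact (Nat.eq_of_mul_eq_mul_right hφ h').symm

/-- **A symmetric type forces `φ(m) ∣ g`** (`n_ζ · φ(m) = g`; for a prime `p`: `(p−1) ∣ g`, sharpening «`(p−1) ∣ 2g`»).
[cite: Zarhin2021PrimeOrderJacobians, §1 (1.1), (1.3) (chunk p0003 L25–L57)] [cite: MoonenZarhin1998WeilClasses, §1 Criterion (chunk p0001 L93–L97)] -/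
theorem totient_dvd_dim_of_symmetric (hm : 0 < m)
    (hδ : (cyclotomic m ℤ).eval₂ (Int.castRingHom (End A)) (End.of δ) = 0)
    (hsym : ∀ ζ : ℂ, IsPrimitiveRoot ζ m → eigenMultiplicity A δ ζ = eigenMultiplicity A δ ζ⁻¹) :
    Nat.totient m ∣ A.dim :=
  Dvd.intro_left _ (((forall_eigenMultiplicity_eq_inv_iff_mul_totient_eq_dim hm hδ).1 hsym) _
    (Complex.isPrimitiveRoot_exp m hm.ne'))

/-- **Moonen–Zarhin's Example for `F = ℚ(ζ_m)`: an ODD degree `r = 2g/φ(m)` makes the type asymmetric** (`n_ζ + n_{ζ⁻¹} = r`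
odd excludes `n_ζ = n_{ζ⁻¹}`; «where the ratios `2dim(Y_i)/[F:ℚ]` are odd. Then non-zero elements of `W_F(Y_i)` are not
Hodge classes»). [cite: MoonenZarhin1998WeilClasses, §1 Example (chunk p0002 L1–L8)] -/
theorem exists_eigenMultiplicity_ne_inv_of_odd (hm : 0 < m)
    (hδ : (cyclotomic m ℤ).eval₂ (Int.castRingHom (End A)) (End.of δ) = 0) (hr : Nat.totient m * r = 2 * A.dim)
    (hodd : Odd r) :
    ∃ ζ : ℂ, IsPrimitiveRoot ζ m ∧ eigenMultiplicity A δ ζ ≠ eigenMultiplicity A δ ζ⁻¹ := by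
  refine ⟨_, Complex.isPrimitiveRoot_exp m hm.ne', fun heq ↦ ?_⟩
  have h := add_eigenMultiplicity_inv_eq_of_isPrimitiveRoot hm hδ hr (Complex.isPrimitiveRoot_exp m hm.ne')
  rw [← heq] at h
  obtain ⟨k, hk⟩ := hodd
  omega

/-- **Odd degree: `0` is the only rational Hodge class of `W_{ℚ(ζ_m)}`** («non-zero elements of `W_F(Y_i)` are not Hodge
classes» when `2dim(Y_i)/[F:ℚ]` is odd). [cite: MoonenZarhin1998WeilClasses, §1 Example (chunk p0002 L1–L8)] -/
theorem eq_zero_of_mem_weilClassesField_cyclotomic_of_odd (hm : 0 < m)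
    (hδ : (cyclotomic m ℤ).eval₂ (Int.castRingHom (End A)) (End.of δ) = 0) (hr : Nat.totient m * r = 2 * A.dim)
    (hodd : Odd r) {c : complexBetti A.X r} (hc : c ∈ weilClassesField A δ (cyclotomic m ℤ) r)
    (hcQ : IsRationalClass c) (hcH : IsOfHodgeType A.dim A.X r (r / 2) (r / 2) c) : c = 0 :=
  eq_zero_of_mem_weilClassesField_cyclotomic hm hδ hr (exists_eigenMultiplicity_ne_inv_of_odd hm hδ hr hodd) hc hcQ hcH

/-- **`φ(m) ∤ g` ⟹ `0` is the only rational Hodge class of `W_{ℚ(ζ_m)}`** (a symmetric type would give `φ(m) ∣ g`).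
[cite: MoonenZarhin1998WeilClasses, §1 Criterion (chunk p0001 L93–L97)] [cite: Zarhin2021PrimeOrderJacobians, §1 (1.3) (chunk p0003 L54–L57)] -/
theorem eq_zero_of_mem_weilClassesField_cyclotomic_of_not_totient_dvd_dim (hm : 0 < m)
    (hδ : (cyclotomic m ℤ).eval₂ (Int.castRingHom (End A)) (End.of δ) = 0) (hr : Nat.totient m * r = 2 * A.dim)
    (hndvd : ¬ Nat.totient m ∣ A.dim) {c : complexBetti A.X r} (hc : c ∈ weilClassesField A δ (cyclotomic m ℤ) r)
    (hcQ : IsRationalClass c) (hcH : IsOfHodgeType A.dim A.X r (r / 2) (r / 2) c) : c = 0 := by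
  refine eq_zero_of_mem_weilClassesField_cyclotomic hm hδ hr ?_ hc hcQ hcH
  by_contra hne
  push Not at hne
  exact hndvd (totient_dvd_dim_of_symmetric hm hδ hne)

end Criterion

/-! ## §2′ Even degree `r = 2k` (`φ(m) · k = g`): the Hodge type `(k, k)` and the decomposable classes -/

section EvenDegree

variable {A : Motives.AbelianVariety ℂ} {δ : A ⟶ A} {m k : ℕ}

/-- `φ(m) · k = g ⟹ φ(m) · 2k = 2g`. [cite: MoonenZarhin1998WeilClasses, §1 (chunk p0001 L32–L41)] -/
private theorem totient_mul_two_mul_eq (hk : Nat.totient m * k = A.dim) : Nat.totient m * (2 * k) = 2 * A.dim := by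
  rw [← hk]; ring

/-- **Criterion (ii) in even degree**: for `r = 2k`, an asymmetric type kills every rational `(k, k)`-class of
`W_{ℚ(ζ_m)} ⊗ ℂ ⊂ H^{2k}`. [cite: MoonenZarhin1998WeilClasses, §1 Criterion (chunk p0001 L93–L97)] -/
theorem eq_zero_of_mem_weilClassesField_cyclotomic_two_mul (hm : 0 < m)
    (hδ : (cyclotomic m ℤ).eval₂ (Int.castRingHom (End A)) (End.of δ) = 0) (hk : Nat.totient m * k = A.dim)
    (hasym : ∃ ζ : ℂ, IsPrimitiveRoot ζ m ∧ eigenMultiplicity A δ ζ ≠ eigenMultiplicity A δ ζ⁻¹)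
    {c : complexBetti A.X (2 * k)} (hc : c ∈ weilClassesField A δ (cyclotomic m ℤ) (2 * k)) (hcQ : IsRationalClass c)
    (hcH : IsOfHodgeType A.dim A.X (2 * k) k k c) : c = 0 := by
  have h := eq_zero_of_mem_weilClassesField_cyclotomic hm hδ (totient_mul_two_mul_eq hk) hasym hc hcQ
  rw [Nat.mul_div_cancel_left k zero_lt_two] at h
  exact h hcH

/-- **Criterion (i) in even degree**: for `r = 2k`, a symmetric type makes every class of `W_{ℚ(ζ_m)} ⊗ ℂ ⊂ H^{2k}` of
type `(k, k)`. [cite: MoonenZarhin1998WeilClasses, §1 Criterion (chunk p0001 L93–L97)] -/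
theorem isOfHodgeType_of_mem_weilClassesField_cyclotomic_two_mul (hm : 0 < m)
    (hδ : (cyclotomic m ℤ).eval₂ (Int.castRingHom (End A)) (End.of δ) = 0) (hk : Nat.totient m * k = A.dim)
    (hsym : ∀ ζ : ℂ, IsPrimitiveRoot ζ m → eigenMultiplicity A δ ζ = eigenMultiplicity A δ ζ⁻¹)
    {c : complexBetti A.X (2 * k)} (hc : c ∈ weilClassesField A δ (cyclotomic m ℤ) (2 * k)) :
    IsOfHodgeType A.dim A.X (2 * k) k k c := by
  have h := isOfHodgeType_of_mem_weilClassesField_cyclotomic hm hδ (totient_mul_two_mul_eq hk) hsym hc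
  rwa [Nat.mul_div_cancel_left k zero_lt_two] at h

/-- **An asymmetric type leaves no decomposable Weil class**: for `r = 2k` and some `n_ζ ≠ n_{ζ⁻¹}`, every non-zero
RATIONAL class of `W_{ℚ(ζ_m)} ⊗ ℂ` lies OUTSIDE the complexified divisor ring `Dᵏ ⊗ ℂ` (decomposable classes are
Hodge). [cite: MoonenZarhin1998WeilClasses, Introduction and §1 Criterion (chunk p0001 L8–L16, L93–L97)] -/
theorem forall_not_mem_divisorClassesSpan_of_exists_eigenMultiplicity_ne_inv (hm : 0 < m)
    (hδ : (cyclotomic m ℤ).eval₂ (Int.castRingHom (End A)) (End.of δ) = 0) (hk : Nat.totient m * k = A.dim)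
    (hasym : ∃ ζ : ℂ, IsPrimitiveRoot ζ m ∧ eigenMultiplicity A δ ζ ≠ eigenMultiplicity A δ ζ⁻¹) :
    ∀ c ∈ weilClassesField A δ (cyclotomic m ℤ) (2 * k), IsRationalClass c → c ≠ 0 →
      c ∉ divisorClassesSpan A.X A.dim k :=
  forall_not_mem_divisorClassesSpan_of_forall_eq_zero fun _ hc hcQ hcH ↦
    eq_zero_of_mem_weilClassesField_cyclotomic_two_mul hm hδ hk hasym hc hcQ hcH

/-- **Moonen–Zarhin's trichotomy for `F = ℚ(ζ_m)`** (`r = 2k ≠ 0`): (a) `0` is the only rational `(k, k)`-class of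
`W ⊗ ℂ` (⟺ asymmetric type); or (b) all of `W ⊗ ℂ` is of type `(k, k)` and decomposable; or (c) all of `W ⊗ ℂ` is of
type `(k, k)` and every non-zero rational Weil class is exceptional («either all elements of `W_F` are Hodge classes,
or `0 ∈ W_F` is the only Hodge class, and in the first case, either `W_F ∖ {0}` consists entirely of exceptional
classes, or none of the classes in `W_F` is exceptional»). [cite: MoonenZarhin1998WeilClasses, §1 «all or nothing»
(chunk p0001 L57–L66)] -/
theorem weilClassesField_cyclotomic_trichotomy (hm : 0 < m)
    (hδ : (cyclotomic m ℤ).eval₂ (Int.castRingHom (End A)) (End.of δ) = 0) (hk : Nat.totient m * k = A.dim)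
    (hk0 : k ≠ 0) :
    (∀ c ∈ weilClassesField A δ (cyclotomic m ℤ) (2 * k),
        IsRationalClass c → IsOfHodgeType A.dim A.X (2 * k) k k c → c = 0) ∨
      ((∀ c ∈ weilClassesField A δ (cyclotomic m ℤ) (2 * k), IsOfHodgeType A.dim A.X (2 * k) k k c) ∧
          weilClassesField A δ (cyclotomic m ℤ) (2 * k) ≤ divisorClassesSpan A.X A.dim k) ∨
        ((∀ c ∈ weilClassesField A δ (cyclotomic m ℤ) (2 * k), IsOfHodgeType A.dim A.X (2 * k) k k c) ∧
          ∀ c ∈ weilClassesField A δ (cyclotomic m ℤ) (2 * k), IsRationalClass c → c ≠ 0 →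
            c ∉ divisorClassesSpan A.X A.dim k) :=
  weilClassesField_trichotomy (natDegree_cyclotomic m ℤ) (irreducible_cyclotomic_int_map_rat hm) hδ
    (totient_mul_two_mul_eq hk) hk0

/-- In even degree the first alternative of the trichotomy is EXACTLY the asymmetric type.
[cite: MoonenZarhin1998WeilClasses, §1 Criterion and «all or nothing» (chunk p0001 L57–L63, L93–L97)] -/
theorem forall_eq_zero_weilClassesField_cyclotomic_two_mul_iff (hm : 0 < m)
    (hδ : (cyclotomic m ℤ).eval₂ (Int.castRingHom (End A)) (End.of δ) = 0) (hk : Nat.totient m * k = A.dim)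
    (hk0 : k ≠ 0) :
    (∀ c ∈ weilClassesField A δ (cyclotomic m ℤ) (2 * k),
        IsRationalClass c → IsOfHodgeType A.dim A.X (2 * k) k k c → c = 0) ↔
      ∃ ζ : ℂ, IsPrimitiveRoot ζ m ∧ eigenMultiplicity A δ ζ ≠ eigenMultiplicity A δ ζ⁻¹ := by
  constructor
  · intro h0
    by_contra hne
    push Not at hne
    obtain ⟨γ, hγW, hγQ, hγH, hγ0⟩ := exists_isRationalClass_isOfHodgeType_ne_zero_of_symmetric hm hδ
      (totient_mul_two_mul_eq hk) (Nat.mul_ne_zero two_ne_zero hk0) hne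
    rw [Nat.mul_div_cancel_left k zero_lt_two] at hγH
    exact hγ0 (h0 γ hγW hγQ hγH)
  · intro hasym c hc hcQ hcH
    exact eq_zero_of_mem_weilClassesField_cyclotomic_two_mul hm hδ hk hasym hc hcQ hcH

end EvenDegree

/-! ## §3 Prime order `p`: `W_{ℚ(ζ_p)} ⊂ H^{2g/(p−1)}` is Hodge ⟺ `𝐚(h) = 𝐚(−h)` ⟺ `𝐚 ≡ g/(p−1)` -/

section PrimeOrder

variable {A : Motives.AbelianVariety ℂ} {δ : A ⟶ A} {p r : ℕ} [hp : Fact p.Prime]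

omit hp in
/-- `ζ^{p−j} = (ζ^j)⁻¹` for `j ≤ p` and `ζ^p = 1` («`−h = (p−j) mod p`»). [cite: Zarhin2021PrimeOrderJacobians, §1 (chunk p0003 L68–L72)] -/
private theorem pow_sub_eq_inv_pow {ζ : ℂ} (hζ : ζ ^ p = 1) {j : ℕ} (hjp : j ≤ p) : ζ ^ (p - j) = (ζ ^ j)⁻¹ :=
  eq_inv_of_mul_eq_one_left (by rw [← pow_add, Nat.sub_add_cancel hjp, hζ])

/-- **Symmetry of the type ⟺ `𝐚(j) = 𝐚(p−j)` for `1 ≤ j < p`** — Zarhin's `G = (ℤ/p)^*`-form: the primitive `p`-th roots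
are `ζ^j`, `1 ≤ j ≤ p−1`, and `(ζ^j)⁻¹ = ζ^{p−j}` («If `h = j mod p` then `−h = (p−j) mod p`»).
[cite: Zarhin2021PrimeOrderJacobians, §1 (1.3)–(1.5), Def. 1.1 (chunk p0003 L54–L88)] -/
theorem forall_eigenMultiplicity_eq_inv_iff_of_prime {ζ : ℂ} (hζ : IsPrimitiveRoot ζ p) :
    (∀ ξ : ℂ, IsPrimitiveRoot ξ p → eigenMultiplicity A δ ξ = eigenMultiplicity A δ ξ⁻¹) ↔
      ∀ j ∈ Finset.Ico 1 p, eigenMultiplicity A δ (ζ ^ j) = eigenMultiplicity A δ (ζ ^ (p - j)) := by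
  constructor
  · intro h j hj
    obtain ⟨hj1, hjp⟩ := Finset.mem_Ico.1 hj
    rw [pow_sub_eq_inv_pow hζ.pow_eq_one hjp.le]
    exact h _ (hζ.pow_of_coprime j (Nat.coprime_of_lt_prime (by omega) hjp hp.out).symm)
  · intro h ξ hξ
    obtain ⟨j, hjp, rfl⟩ := hζ.eq_pow_of_pow_eq_one hξ.pow_eq_one
    have hj1 : 1 ≤ j := by
      refine Nat.one_le_iff_ne_zero.2 ?_
      rintro rfl
      rw [pow_zero] at hξ
      exact hξ.ne_one hp.out.one_lt rfl
    rw [← pow_sub_eq_inv_pow hζ.pow_eq_one hjp.le]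
    exact h j (Finset.mem_Ico.2 ⟨hj1, hjp⟩)

/-- **Symmetry ⟺ `𝐚(j) · (p−1) = g` for all `1 ≤ j < p`**: the only symmetric admissible function is the constant
`g/(p−1)` («We say that `f` is admissible if `𝐚(h) + 𝐚(−h) = 2g/(p−1)`»).
[cite: Zarhin2021PrimeOrderJacobians, §1 Def. 1.1, Rem. 1.2 (chunk p0003 L77–L92)] -/
theorem forall_eigenMultiplicity_eq_inv_iff_mul_sub_one_eq_dim_of_prime
    (hδ : (cyclotomic p ℤ).eval₂ (Int.castRingHom (End A)) (End.of δ) = 0) {ζ : ℂ} (hζ : IsPrimitiveRoot ζ p) :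
    (∀ ξ : ℂ, IsPrimitiveRoot ξ p → eigenMultiplicity A δ ξ = eigenMultiplicity A δ ξ⁻¹) ↔
      ∀ j ∈ Finset.Ico 1 p, eigenMultiplicity A δ (ζ ^ j) * (p - 1) = A.dim := by
  rw [forall_eigenMultiplicity_eq_inv_iff_mul_totient_eq_dim hp.out.pos hδ, Nat.totient_prime hp.out]
  constructor
  · intro h j hj
    obtain ⟨hj1, hjp⟩ := Finset.mem_Ico.1 hj
    exact h _ (hζ.pow_of_coprime j (Nat.coprime_of_lt_prime (by omega) hjp hp.out).symm)
  · intro h ξ hξ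
    obtain ⟨j, hjp, rfl⟩ := hζ.eq_pow_of_pow_eq_one hξ.pow_eq_one
    have hj1 : 1 ≤ j := by
      refine Nat.one_le_iff_ne_zero.2 ?_
      rintro rfl
      rw [pow_zero] at hξ
      exact hξ.ne_one hp.out.one_lt rfl
    exact h j (Finset.mem_Ico.2 ⟨hj1, hjp⟩)

/-- **Prime order, (i)**: if `𝐚(j) = 𝐚(p−j)` for all `1 ≤ j < p` then every class of `W_{ℚ(ζ_p)} ⊗ ℂ ⊂ Hʳ(A(ℂ); ℂ)`,
`r(p−1) = 2g`, is of Hodge type `(r/2, r/2)`. [cite: MoonenZarhin1998WeilClasses, §1 Criterion (chunk p0001 L93–L97)]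
[cite: Zarhin2021PrimeOrderJacobians, §1 Def. 1.1 (chunk p0003 L77–L88)] -/
theorem isOfHodgeType_of_mem_weilClassesField_cyclotomic_of_prime
    (hδ : (cyclotomic p ℤ).eval₂ (Int.castRingHom (End A)) (End.of δ) = 0) (hr : (p - 1) * r = 2 * A.dim)
    {ζ : ℂ} (hζ : IsPrimitiveRoot ζ p)
    (hsym : ∀ j ∈ Finset.Ico 1 p, eigenMultiplicity A δ (ζ ^ j) = eigenMultiplicity A δ (ζ ^ (p - j)))
    {c : complexBetti A.X r} (hc : c ∈ weilClassesField A δ (cyclotomic p ℤ) r) :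
    IsOfHodgeType A.dim A.X r (r / 2) (r / 2) c :=
  isOfHodgeType_of_mem_weilClassesField_cyclotomic hp.out.pos hδ (by rwa [Nat.totient_prime hp.out])
    ((forall_eigenMultiplicity_eq_inv_iff_of_prime hζ).2 hsym) hc

/-- **Prime order, (ii)**: if `𝐚(j) ≠ 𝐚(p−j)` for some `1 ≤ j < p` then every rational `(r/2, r/2)`-class of
`W_{ℚ(ζ_p)} ⊗ ℂ` is `0`. [cite: MoonenZarhin1998WeilClasses, §1 Criterion (chunk p0001 L93–L97)]
[cite: Zarhin2021PrimeOrderJacobians, §1 Def. 1.1 (chunk p0003 L77–L88)] -/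
theorem eq_zero_of_mem_weilClassesField_cyclotomic_of_prime
    (hδ : (cyclotomic p ℤ).eval₂ (Int.castRingHom (End A)) (End.of δ) = 0) (hr : (p - 1) * r = 2 * A.dim)
    {ζ : ℂ} (hζ : IsPrimitiveRoot ζ p)
    (hasym : ∃ j ∈ Finset.Ico 1 p, eigenMultiplicity A δ (ζ ^ j) ≠ eigenMultiplicity A δ (ζ ^ (p - j)))
    {c : complexBetti A.X r} (hc : c ∈ weilClassesField A δ (cyclotomic p ℤ) r) (hcQ : IsRationalClass c)
    (hcH : IsOfHodgeType A.dim A.X r (r / 2) (r / 2) c) : c = 0 := by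
  refine eq_zero_of_mem_weilClassesField_cyclotomic hp.out.pos hδ (by rwa [Nat.totient_prime hp.out]) ?_ hc hcQ hcH
  by_contra hne
  push Not at hne
  obtain ⟨j, hj, hne'⟩ := hasym
  exact hne' ((forall_eigenMultiplicity_eq_inv_iff_of_prime hζ).1 hne j hj)

/-- **`(p−1) ∤ g` ⟹ `0` is the only rational Hodge class in `W_{ℚ(ζ_p)} ⊂ H^{2g/(p−1)}`** (in particular whenever
`2g/(p−1)` is odd). [cite: MoonenZarhin1998WeilClasses, §1 Criterion, Example (chunk p0001 L93–L97, p0002 L1–L8)]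
[cite: Zarhin2021PrimeOrderJacobians, §1 (1.1) (chunk p0003 L25–L29)] -/
theorem eq_zero_of_mem_weilClassesField_cyclotomic_of_not_sub_one_dvd_dim
    (hδ : (cyclotomic p ℤ).eval₂ (Int.castRingHom (End A)) (End.of δ) = 0) (hr : (p - 1) * r = 2 * A.dim)
    (hndvd : ¬ (p - 1) ∣ A.dim) {c : complexBetti A.X r} (hc : c ∈ weilClassesField A δ (cyclotomic p ℤ) r)
    (hcQ : IsRationalClass c) (hcH : IsOfHodgeType A.dim A.X r (r / 2) (r / 2) c) : c = 0 :=
  eq_zero_of_mem_weilClassesField_cyclotomic_of_not_totient_dvd_dim hp.out.pos hδ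
    (by rwa [Nat.totient_prime hp.out]) (by rwa [Nat.totient_prime hp.out]) hc hcQ hcH

/-- **Prime order, the tangible form**: `A` carries a non-zero rational Hodge class of type `(r/2, r/2)` in
`W_{ℚ(ζ_p)} ⊗ ℂ ⊂ Hʳ` (`r ≠ 0`) iff Zarhin's function is the constant `g/(p−1)`.
[cite: MoonenZarhin1998WeilClasses, §1 Criterion (chunk p0001 L93–L97)] [cite: Zarhin2021PrimeOrderJacobians, §1 Def. 1.1, Rem. 1.2 (chunk p0003 L77–L92)] -/
theorem exists_isRationalClass_isOfHodgeType_ne_zero_iff_of_prime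
    (hδ : (cyclotomic p ℤ).eval₂ (Int.castRingHom (End A)) (End.of δ) = 0) (hr : (p - 1) * r = 2 * A.dim)
    (hr0 : r ≠ 0) {ζ : ℂ} (hζ : IsPrimitiveRoot ζ p) :
    (∃ γ ∈ weilClassesField A δ (cyclotomic p ℤ) r,
        IsRationalClass γ ∧ IsOfHodgeType A.dim A.X r (r / 2) (r / 2) γ ∧ γ ≠ 0) ↔
      ∀ j ∈ Finset.Ico 1 p, eigenMultiplicity A δ (ζ ^ j) * (p - 1) = A.dim := by
  rw [exists_isRationalClass_isOfHodgeType_ne_zero_cyclotomic_iff hp.out.pos hδ (by rwa [Nat.totient_prime hp.out]) hr0,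
    forall_eigenMultiplicity_eq_inv_iff_mul_sub_one_eq_dim_of_prime hδ hζ]

end PrimeOrder

/-! ## §4 Zarhin's Example 1.3: `W_{ℚ(ζ_3)}(E^{f(1)} × E^{f(2)}) ⊂ H^{f(1)+f(2)}` is Hodge ⟺ `f(1) = f(2)` -/

section ZarhinExample

variable {E : Motives.AbelianVariety ℂ} {δE : E ⟶ E} {ι : Type} [Fintype ι] (s : ι → Bool)

/-- A primitive cube root of unity is `ω` or `ω⁻¹ = ω²`. [cite: Zarhin2021PrimeOrderJacobians, §1 Example 1.3 (chunk p0003 L88–L104)] -/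
private theorem eq_or_eq_inv_of_isPrimitiveRoot_three {ω ξ : ℂ} (hω : IsPrimitiveRoot ω 3) (hξ : IsPrimitiveRoot ξ 3) :
    ξ = ω ∨ ξ = ω⁻¹ := by
  obtain ⟨j, hj3, rfl⟩ := hω.eq_pow_of_pow_eq_one hξ.pow_eq_one
  interval_cases j
  · rw [pow_zero] at hξ
    exact absurd rfl (hξ.ne_one (by norm_num))
  · exact Or.inl (pow_one ω)
  · refine Or.inr (eq_inv_of_mul_eq_one_left ?_)
    rw [show ω ^ 2 * ω = ω ^ 3 by ring]
    exact hω.pow_eq_one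

/-- `φ(3) · |ι| = 2 dim Y` for `Y = ⨁_ι E` with `dim E = 1`: the Weil classes of `ℚ(ζ_3)` on `Y` live in degree
`r = g = f(1) + f(2)`. [cite: Zarhin2021PrimeOrderJacobians, §1 Example 1.3 (chunk p0003 L93–L96)]
[cite: MoonenZarhin1998WeilClasses, §1 (chunk p0001 L32–L41)] -/
theorem totient_three_mul_card_eq_two_mul_dim_zarhinExample (hE : E.dim = 1) :
    Nat.totient 3 * Fintype.card ι = 2 * (⨁ fun _ : ι ↦ E).dim := by
  rw [dim_zarhinExample, hE, mul_one, Nat.totient_prime Nat.prime_three]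

/-- **The type of `δ_3` is symmetric iff `f(1) = f(2)`** (`𝐚_Y(ω) = f(1)`, `𝐚_Y(ω²) = f(2)`).
[cite: Zarhin2021PrimeOrderJacobians, §1 Example 1.3 (chunk p0003 L88–L104)] -/
theorem forall_eigenMultiplicity_zarhinExample_eq_inv_iff (hE : E.dim = 1)
    (hδE : (cyclotomic 3 ℤ).eval₂ (Int.castRingHom (End E)) (End.of δE) = 0) {ω : ℂ} (hω : IsPrimitiveRoot ω 3)
    (h1 : eigenMultiplicity E δE ω = 1) :
    (∀ ξ : ℂ, IsPrimitiveRoot ξ 3 →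
        eigenMultiplicity (⨁ fun _ : ι ↦ E) (biproduct.map fun j : ι ↦ if s j then δE else δE ≫ δE) ξ =
          eigenMultiplicity (⨁ fun _ : ι ↦ E) (biproduct.map fun j : ι ↦ if s j then δE else δE ≫ δE) ξ⁻¹) ↔
      (Finset.univ.filter fun j ↦ s j = true).card = (Finset.univ.filter fun j ↦ s j = false).card := by
  obtain ⟨hω1, hω2⟩ := eigenMultiplicity_zarhinExample_eq_card s hE hδE hω h1
  constructor
  · intro h
    have := h ω hω
    rwa [hω1, hω2] at this
  · intro h ξ hξ
    rcases eq_or_eq_inv_of_isPrimitiveRoot_three hω hξ with rfl | rfl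
    · rw [hω1, hω2, h]
    · rw [inv_inv, hω1, hω2, h]

/-- **Zarhin's Example 1.3 through Moonen–Zarhin: ALL of `W_{ℚ(ζ_3)}(Y) ⊗ ℂ ⊂ H^{|ι|}(Y(ℂ); ℂ)` is of Hodge type
`(|ι|/2, |ι|/2)` iff `f(1) = f(2)`** — on `Y = E^{f(1)} × E^{f(2)}` (`f(1) = #{s = true}`, `f(2) = #{s = false}`) with
`δ_3 = (δ_E on the first block, δ_E⁻¹ on the second)`, `E` a curve with `Φ_3(δ_E) = 0`, `n_ω(δ_E) = 1`.
[cite: Zarhin2021PrimeOrderJacobians, §1 Example 1.3 (chunk p0003 L88–L104)] [cite: MoonenZarhin1998WeilClasses, §1 Criterion (chunk p0001 L93–L97)] -/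
theorem forall_isOfHodgeType_weilClassesField_zarhinExample_iff (hE : E.dim = 1)
    (hδE : (cyclotomic 3 ℤ).eval₂ (Int.castRingHom (End E)) (End.of δE) = 0) {ω : ℂ} (hω : IsPrimitiveRoot ω 3)
    (h1 : eigenMultiplicity E δE ω = 1) :
    (∀ c ∈ weilClassesField (⨁ fun _ : ι ↦ E) (biproduct.map fun j : ι ↦ if s j then δE else δE ≫ δE)
        (cyclotomic 3 ℤ) (Fintype.card ι),
        IsOfHodgeType (⨁ fun _ : ι ↦ E).dim (⨁ fun _ : ι ↦ E).X (Fintype.card ι)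
          (Fintype.card ι / 2) (Fintype.card ι / 2) c) ↔
      (Finset.univ.filter fun j ↦ s j = true).card = (Finset.univ.filter fun j ↦ s j = false).card := by
  rw [forall_isOfHodgeType_weilClassesField_cyclotomic_iff (by norm_num : 0 < 3)
    (eval₂_cyclotomic_three_zarhinExample_eq_zero s hδE) (totient_three_mul_card_eq_two_mul_dim_zarhinExample hE),
    forall_eigenMultiplicity_zarhinExample_eq_inv_iff s hE hδE hω h1]

/-- **`f(1) = f(2)`, `Y ≠ 0` ⟹ a NON-ZERO RATIONAL HODGE CLASS of type `(f(1), f(1))` in `W_{ℚ(ζ_3)}(Y) ⊗ ℂ ⊂ H^{2f(1)}(Y)`**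
(Weil–Hodge classes on the self-product `E^{f} × E^{f}` of the `ℤ[ζ_3]`-curve).
[cite: Zarhin2021PrimeOrderJacobians, §1 Example 1.3 (chunk p0003 L88–L104)] [cite: MoonenZarhin1998WeilClasses, §1 Criterion (chunk p0001 L93–L97)] -/
theorem exists_isRationalClass_isOfHodgeType_ne_zero_zarhinExample [Nonempty ι] (hE : E.dim = 1)
    (hδE : (cyclotomic 3 ℤ).eval₂ (Int.castRingHom (End E)) (End.of δE) = 0) {ω : ℂ} (hω : IsPrimitiveRoot ω 3)
    (h1 : eigenMultiplicity E δE ω = 1)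
    (hs : (Finset.univ.filter fun j ↦ s j = true).card = (Finset.univ.filter fun j ↦ s j = false).card) :
    ∃ γ ∈ weilClassesField (⨁ fun _ : ι ↦ E) (biproduct.map fun j : ι ↦ if s j then δE else δE ≫ δE)
        (cyclotomic 3 ℤ) (Fintype.card ι),
      IsRationalClass γ ∧ IsOfHodgeType (⨁ fun _ : ι ↦ E).dim (⨁ fun _ : ι ↦ E).X (Fintype.card ι)
        (Fintype.card ι / 2) (Fintype.card ι / 2) γ ∧ γ ≠ 0 :=
  exists_isRationalClass_isOfHodgeType_ne_zero_of_symmetric (by norm_num : 0 < 3)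
    (eval₂_cyclotomic_three_zarhinExample_eq_zero s hδE) (totient_three_mul_card_eq_two_mul_dim_zarhinExample hE)
    Fintype.card_ne_zero ((forall_eigenMultiplicity_zarhinExample_eq_inv_iff s hE hδE hω h1).2 hs)

/-- **`f(1) ≠ f(2)` ⟹ `0` is the only rational Hodge class of `W_{ℚ(ζ_3)}(Y)`** — e.g. `Y = E^{f}` with the diagonal
`δ_E` (`f(2) = 0 < f`): the Weil classes `⋀^f_{ℚ(ζ_3)} H¹(E^f, ℚ) ⊂ H^f` carry no non-zero Hodge class.
[cite: Zarhin2021PrimeOrderJacobians, §1 Example 1.3 (chunk p0003 L88–L104)] [cite: MoonenZarhin1998WeilClasses, §1 Criterion (chunk p0001 L93–L97)] -/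
theorem eq_zero_of_mem_weilClassesField_zarhinExample (hE : E.dim = 1)
    (hδE : (cyclotomic 3 ℤ).eval₂ (Int.castRingHom (End E)) (End.of δE) = 0) {ω : ℂ} (hω : IsPrimitiveRoot ω 3)
    (h1 : eigenMultiplicity E δE ω = 1)
    (hs : (Finset.univ.filter fun j ↦ s j = true).card ≠ (Finset.univ.filter fun j ↦ s j = false).card)
    {c : complexBetti (⨁ fun _ : ι ↦ E).X (Fintype.card ι)}
    (hc : c ∈ weilClassesField (⨁ fun _ : ι ↦ E) (biproduct.map fun j : ι ↦ if s j then δE else δE ≫ δE)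
      (cyclotomic 3 ℤ) (Fintype.card ι))
    (hcQ : IsRationalClass c)
    (hcH : IsOfHodgeType (⨁ fun _ : ι ↦ E).dim (⨁ fun _ : ι ↦ E).X (Fintype.card ι)
      (Fintype.card ι / 2) (Fintype.card ι / 2) c) : c = 0 := by
  obtain ⟨hω1, hω2⟩ := eigenMultiplicity_zarhinExample_eq_card s hE hδE hω h1
  refine eq_zero_of_mem_weilClassesField_cyclotomic (by norm_num : 0 < 3)
    (eval₂_cyclotomic_three_zarhinExample_eq_zero s hδE) (totient_three_mul_card_eq_two_mul_dim_zarhinExample hE)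
    ⟨ω, hω, ?_⟩ hc hcQ hcH
  rwa [hω1, hω2]

end ZarhinExample

end AbelianVariety

end Literature.AlgebraicGeometry.HodgeTheory

end
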